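import Summits.CriticalPhenomena.CardyFormulaZ2.Theorems.CardyBoundaryCoulombGasRectilinearCardyStubKernelWindowLawPart5
import Summits.CriticalPhenomena.CardyFormulaZ2.Theorems.CardyBoundaryCoulombGasRectilinearCardyStubKernelWindowLawPart4
import Summits.CriticalPhenomena.CardyFormulaZ2.Theorems.RectilinearCardy.Negative.RectilinearCardyReductions
import HarnessLib

/-!
# Stub `stub_kernelWindowLaw` of line `excursion-kernel-covariance`: the kernel window law
# (crux `RectilinearCardy`, stmt-CriticalPhenomena-5660, route `CardyBoundaryCoulombGas`)

The registered statement: for a rectilinear conformal rectangle `R = (Ω; a, b, c, d)` with flat marks,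
a boundary correspondence `g` (datum of `stub_boundaryCorrespondence`), a holomorphic extension `w` of
the inverse uniformizer across the flat pieces (`stub_schwarzExtension`: `w(∂Ω(t)) = g t` at flat
`t ∈ [0, mark 3]`) and a normaliser `N > 0` with the UNIFORM POINT ASYMPTOTICS of the cube-root weight
on flat windows (`stub_kernelPointAsymptotics`, taken as hypothesis), there is ONE positive `c δ` with
`c δ · (rowMass R δ s - rowMass R δ s') → C(s) - C(s')` as `δ → 0⁺` for every fixed window `[s, s']` in
an admissible range, `C(s) = F(η(g a, g b, g s, g d))`.

Proof (parts 1–5 carry the pieces): `c δ = κ / N δ`, `κ = (cardyConst/3)|(x₁-x₀)(x₃-x₀)(x₃-x₁)|^{1/3}`,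
`xᵢ = g(mark i)`. Enlarge the admissible range so that `[s, s']` is strictly inside (part 1); the
enlarged window is one straight side `{nrmC o = h}` (part 1, `kwl_exists_windowFrame`); the vertices
of `rowTail s ∖ rowTail s'` are the points of ONE lattice row whose feet are the lattice points of the
chord `[T s, T s']` of the side (part 2), so by the point asymptotics the renormalised window mass
`(Σ rowWeight)/N δ` is a Riemann sum of `Φ_w(x e + h ν)`, `Φ_w = |w′| (∏ᵢ |w - w(pt i)|²)^{-1/3}`, and
converges to `∫_chord Φ_w` (parts 3, 5); along the chord `w` is real (`= g`) and injective, so the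
change of variables `y = w` gives `|∫_{g s}^{g s'} |(y-x₀)(y-x₁)(y-x₃)|^{-2/3} dy|` (part 4,
`kwl_side_integral`), and `C(s) - C(s')` is `κ` times the same integral (part 4,
`kwl_cardy_window_increment`, the integrated Cardy ODE of the landed `stub_betaRatioIdentity`).

[folklore] (Riemann sums + change of variables + beta calculus); no percolation or potential theory is
used beyond the hypotheses.
-/

noncomputable section

open Set Filter Topology Metric MeasureTheory
open Literature.Probability.RandomPlanarGeometry
open Literature.Probability.LatticeModels (Site meshPoint meshVertices meshVertices_finite dirichletGreen
  zdGraph Orient)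
open Summit.CriticalPhenomena.CardyFormulaZ2.Theorems.RectilinearCardy.Negative (IsRectilinear)
open UpperHalfPlane (upperHalfPlaneSet)

namespace Summit.CriticalPhenomena.CardyFormulaZ2.Cruxes.RectilinearCardy.ExcursionKernelCovariance

/-- The continuum point kernel at a REAL value `y` of `w`, with real pole values `xᵢ`:
`(∏ᵢ |y - xᵢ|²)^{-1/3} = |(y-x₀)(y-x₁)(y-x₃)|^{-2/3}`. [folklore] -/
theorem kwl_kernel_real (y x₀ x₁ x₃ : ℝ) :
    (‖((y : ℝ) : ℂ) - ((x₀ : ℝ) : ℂ)‖ ^ 2 * ‖((y : ℝ) : ℂ) - ((x₁ : ℝ) : ℂ)‖ ^ 2 *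
        ‖((y : ℝ) : ℂ) - ((x₃ : ℝ) : ℂ)‖ ^ 2) ^ (-(1 / 3 : ℝ)) =
      |(y - x₀) * (y - x₁) * (y - x₃)| ^ (-(2 / 3 : ℝ)) := by
  have hn : ∀ a : ℝ, ‖((y : ℝ) : ℂ) - ((a : ℝ) : ℂ)‖ = |y - a| := fun a => by
    rw [← Complex.ofReal_sub, Complex.norm_real, Real.norm_eq_abs]
  rw [hn, hn, hn, show |y - x₀| ^ 2 * |y - x₁| ^ 2 * |y - x₃| ^ 2 =
    |(y - x₀) * (y - x₁) * (y - x₃)| ^ 2 by rw [abs_mul, abs_mul]; ring]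
  rw [show (-(2 / 3 : ℝ)) = 2 * (-(1 / 3 : ℝ)) by norm_num, Real.rpow_mul (abs_nonneg _),
    Real.rpow_two]

/-- **Stub `stub_kernelWindowLaw` (registered statement, verbatim): the kernel window law from the
uniform point asymptotics.** See the module docstring for the proof. [folklore] -/
theorem stub_kernelWindowLaw :
    ∀ R : ConformalRectangle, IsRectilinear R → (∀ i : Fin 4, ∃ r : ℝ, 0 < r ∧ FlatNear R (R.pt i) r) →
      ∀ (φ : ConformalEquiv upperHalfPlaneSet R.carrier) (g : ℝ → ℝ) (S₀ S : ℝ) (w₀ : ℂ → ℂ),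
        S₀ < 0 → R.mark 3 < S → S < 1 → S < S₀ + 1 →
        ContinuousOn g (Icc S₀ S) → (StrictMonoOn g (Icc S₀ S) ∨ StrictAntiOn g (Icc S₀ S)) →
        (∀ t ∈ Icc S₀ S, φ.HasBoundaryValue (g t) (R.boundary t)) →
        EqOn w₀ φ.symm R.carrier → ContinuousOn w₀ (R.carrier ∪ R.boundary '' Icc S₀ S) →
        (∀ t ∈ Icc S₀ S, w₀ (R.boundary t) = g t) →
        ∀ (U : Set ℂ) (w : ℂ → ℂ), IsOpen U → R.carrier ⊆ U →
          (∀ t ∈ Icc (0 : ℝ) (R.mark 3), (∃ r : ℝ, 0 < r ∧ FlatNear R (R.boundary t) r) →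
            R.boundary t ∈ U ∧ w (R.boundary t) = g t) →
          DifferentiableOn ℂ w U → BijOn w R.carrier {z : ℂ | 0 < z.im} → EqOn w φ.symm R.carrier →
          ∀ N : ℝ → ℝ, (∀ δ, 0 < N δ) →
            (∀ σ σ' : ℝ, AdmissibleRange R σ σ' → R.boundary '' Icc σ σ' ⊆ U →
              (∀ τ ∈ Icc σ σ', w (R.boundary τ) ≠ w (R.pt 0) ∧ w (R.boundary τ) ≠ w (R.pt 1) ∧
                w (R.boundary τ) ≠ w (R.pt 3)) →
              ∀ ε : ℝ, 0 < ε → ∀ᶠ δ in 𝓝[>] (0 : ℝ), ∀ v ∈ boundaryRow R δ, ∀ τ ∈ Icc σ σ',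
                dist (meshPoint δ v) (R.boundary τ) ≤ 4 * δ →
                  |rowWeight R δ v / (δ * N δ) -
                      ‖deriv w (R.boundary τ)‖ *
                        (‖w (R.boundary τ) - w (R.pt 0)‖ ^ 2 * ‖w (R.boundary τ) - w (R.pt 1)‖ ^ 2 *
                            ‖w (R.boundary τ) - w (R.pt 3)‖ ^ 2) ^ (-(1 / 3 : ℝ))| ≤ ε) →
            ∃ c : ℝ → ℝ, (∀ δ, 0 < c δ) ∧
              ∀ σ σ' : ℝ, AdmissibleRange R σ σ' → ∀ s s' : ℝ, σ ≤ s → s ≤ s' → s' ≤ σ' →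
                Tendsto (fun δ => c δ * (rowMass R δ s - rowMass R δ s')) (𝓝[>] 0)
                  (𝓝 (cardyFunction (crossRatio ![g (R.mark 0), g (R.mark 1), g s, g (R.mark 3)]) -
                    cardyFunction (crossRatio ![g (R.mark 0), g (R.mark 1), g s', g (R.mark 3)]))) := by
  intro R _ hF φ g S₀ S _ hS₀ h3S _ _ _ hgm _ _ _ _ U w hUo _ hflatU hwd _ _ N hNpos hN
  -- order bookkeeping
  have h01 : R.mark 0 < R.mark 1 := R.strictMono_mark (show (0 : Fin 4) < 1 by decide)
  have h13 : R.mark 1 < R.mark 3 := R.strictMono_mark (show (1 : Fin 4) < 3 by decide)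
  have hm0 : 0 ≤ R.mark 0 := (R.mark_mem 0).1
  have hI : ∀ t : ℝ, 0 ≤ t → t ≤ R.mark 3 → t ∈ Icc S₀ S := fun t ht0 ht3 =>
    ⟨by linarith, by linarith⟩
  have hginj : InjOn g (Icc S₀ S) := hgm.elim StrictMonoOn.injOn StrictAntiOn.injOn
  have hmk : ∀ i : Fin 4, R.mark i ∈ Icc (0 : ℝ) (R.mark 3) := fun i =>
    ⟨(R.mark_mem i).1, R.strictMono_mark.monotone (Fin.le_last i)⟩
  have hwpt : ∀ i : Fin 4, w (R.pt i) = g (R.mark i) := fun i => (hflatU (R.mark i) (hmk i) (hF i)).2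
  have hmkI : ∀ i : Fin 4, R.mark i ∈ Icc S₀ S := fun i => hI _ (hmk i).1 (hmk i).2
  -- the constant `κ` and the normalising family `c δ = κ / N δ`
  set κ : ℝ := cardyConst / 3 *
    |(g (R.mark 1) - g (R.mark 0)) * (g (R.mark 3) - g (R.mark 0)) * (g (R.mark 3) - g (R.mark 1))| ^
      (1 / 3 : ℝ) with hκ
  have hκpos : 0 < κ :=
    kwl_kappa_pos (fun h => h01.ne (hginj (hmkI 0) (hmkI 1) h))
      (fun h => (h01.trans h13).ne (hginj (hmkI 0) (hmkI 3) h)) (fun h => h13.ne (hginj (hmkI 1) (hmkI 3) h))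
  refine ⟨fun δ => κ / N δ, fun δ => div_pos hκpos (hNpos δ), ?_⟩
  intro σ σ' hadm s s' hs hss' hs'
  rcases hss'.eq_or_lt with rfl | hlt
  · simp only [sub_self, mul_zero]; exact tendsto_const_nhds
  -- enlarge the range and straighten the window
  obtain ⟨σ₁, σ₁', hadm₁, hσ₁s, hs'σ₁'⟩ := kwl_exists_admissible_enlarge R hadm hs hss' hs'
  have h1 : R.mark 1 < σ₁ := hadm₁.1
  have h3 : σ₁' < R.mark 3 := hadm₁.2.2.1
  obtain ⟨o, h, r, hr, hW⟩ := kwl_exists_windowFrame R hadm₁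
  have hh : ∀ t ∈ Icc σ₁ σ₁', Orient.nrmC o (R.boundary t) = h := fun t ht => (hW t ht).1
  have hcl : ∀ t ∈ Icc σ₁ σ₁', ∀ z, dist z (R.boundary t) < r →
      (z ∈ closure R.carrier ↔ h ≤ Orient.nrmC o z) := fun t ht => (hW t ht).2.1
  have hop : ∀ t ∈ Icc σ₁ σ₁', ∀ z, dist z (R.boundary t) < r →
      (z ∈ R.carrier ↔ h < Orient.nrmC o z) := fun t ht => (hW t ht).2.2
  -- window points are flat: they lie in `U` and `w = g` there
  have hwin : ∀ t ∈ Icc σ₁ σ₁', R.boundary t ∈ U ∧ w (R.boundary t) = g t := by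
    intro t ht
    obtain ⟨-, -, -, ρ, hρ, hfl⟩ := hadm₁
    exact hflatU t ⟨by linarith [ht.1], by linarith [ht.2]⟩ ⟨ρ, hρ, hfl t ht⟩
  have hwinI : ∀ t ∈ Icc σ₁ σ₁', t ∈ Icc S₀ S := fun t ht => hI t (by linarith [ht.1]) (by linarith [ht.2])
  have hwinU : R.boundary '' Icc σ₁ σ₁' ⊆ U := by
    rintro _ ⟨t, ht, rfl⟩; exact (hwin t ht).1
  have hsep : ∀ τ ∈ Icc σ₁ σ₁', w (R.boundary τ) ≠ w (R.pt 0) ∧ w (R.boundary τ) ≠ w (R.pt 1) ∧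
      w (R.boundary τ) ≠ w (R.pt 3) := by
    intro τ hτ
    rw [(hwin τ hτ).2, hwpt 0, hwpt 1, hwpt 3]
    refine ⟨fun heq => ?_, fun heq => ?_, fun heq => ?_⟩
    · have := hginj (hwinI τ hτ) (hmkI 0) (Complex.ofReal_injective heq); linarith [hτ.1]
    · have := hginj (hwinI τ hτ) (hmkI 1) (Complex.ofReal_injective heq); linarith [hτ.1]
    · have := hginj (hwinI τ hτ) (hmkI 3) (Complex.ofReal_injective heq); linarith [hτ.2]
  -- the continuum point kernel and the point asymptotics on the enlarged range
  set Φ : ℂ → ℝ := fun z => ‖deriv w z‖ *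
    (‖w z - w (R.pt 0)‖ ^ 2 * ‖w z - w (R.pt 1)‖ ^ 2 * ‖w z - w (R.pt 3)‖ ^ 2) ^ (-(1 / 3 : ℝ)) with hΦ
  have hNΦ : ∀ ε : ℝ, 0 < ε → ∀ᶠ δ in 𝓝[>] (0 : ℝ), ∀ v ∈ boundaryRow R δ, ∀ τ ∈ Icc σ₁ σ₁',
      dist (meshPoint δ v) (R.boundary τ) ≤ 4 * δ →
        |rowWeight R δ v / (δ * N δ) - Φ (R.boundary τ)| ≤ ε :=
    hN σ₁ σ₁' hadm₁ hwinU hsep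
  -- the chord of the window
  set T : ℝ → ℝ := fun t => Orient.tngC o (R.boundary t) with hT
  set P : ℝ → ℂ := fun x => ((x : ℝ) : ℂ) * Orient.e o + ((h : ℝ) : ℂ) * Orient.ν o with hP
  set α : ℝ := T s ⊓ T s' with hα
  set β : ℝ := T s ⊔ T s' with hβ
  have hsI : s ∈ Icc σ₁ σ₁' := ⟨hσ₁s.le, hlt.le.trans hs'σ₁'.le⟩
  have hs'I : s' ∈ Icc σ₁ σ₁' := ⟨hσ₁s.le.trans hlt.le, hs'σ₁'.le⟩
  have hTne : T s ≠ T s' := fun heq => hlt.ne (kwl_injOn_tng R h1 h3 hh hsI hs'I heq)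
  have hαβ : α < β := by
    rcases lt_or_gt_of_ne hTne with hlt' | hlt'
    · rw [hα, hβ, inf_eq_left.2 hlt'.le, sup_eq_right.2 hlt'.le]; exact hlt'
    · rw [hα, hβ, inf_eq_right.2 hlt'.le, sup_eq_left.2 hlt'.le]; exact hlt'
  have hchord : ∀ x ∈ Icc α β, ∃ u ∈ Icc s s', T u = x ∧ R.boundary u = P x := fun x hx =>
    kwl_exists_param_of_mem_uIcc R hlt.le (fun t ht => hh t ⟨hσ₁s.le.trans ht.1, ht.2.trans hs'σ₁'.le⟩) hx
  have huI : ∀ u ∈ Icc s s', u ∈ Icc σ₁ σ₁' := fun u hu => ⟨hσ₁s.le.trans hu.1, hu.2.trans hs'σ₁'.le⟩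
  have hPU : ∀ x ∈ Icc α β, P x ∈ U := fun x hx => by
    obtain ⟨u, hu, -, hbu⟩ := hchord x hx
    rw [← hbu]; exact (hwin u (huI u hu)).1
  have hPg : ∀ x ∈ Icc α β, ∃ u ∈ Icc s s', T u = x ∧ R.boundary u = P x ∧ w (P x) = g u :=
    fun x hx => by
    obtain ⟨u, hu, hTu, hbu⟩ := hchord x hx
    exact ⟨u, hu, hTu, hbu, by rw [← hbu]; exact (hwin u (huI u hu)).2⟩
  have hreal : ∀ x ∈ Icc α β, (w (P x)).im = 0 := fun x hx => by
    obtain ⟨u, -, -, -, hwu⟩ := hPg x hx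
    rw [hwu, Complex.ofReal_im]
  have hinj : InjOn (fun x : ℝ => (w (P x)).re) (Icc α β) := by
    intro x hx x' hx' heq
    obtain ⟨u, hu, hTu, -, hwu⟩ := hPg x hx
    obtain ⟨u', hu', hTu', -, hwu'⟩ := hPg x' hx'
    simp only at heq
    rw [hwu, hwu', Complex.ofReal_re, Complex.ofReal_re] at heq
    have := hginj (hwinI u (huI u hu)) (hwinI u' (huI u' hu')) heq
    rw [← hTu, ← hTu', this]
  -- the beta weight and its continuity on the real image of the chord
  set G : ℝ → ℝ := fun y =>
    |(y - g (R.mark 0)) * (y - g (R.mark 1)) * (y - g (R.mark 3))| ^ (-(2 / 3 : ℝ)) with hG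
  have hG0 : ∀ y, 0 ≤ G y := fun y => Real.rpow_nonneg (abs_nonneg _) _
  have hGc : ContinuousOn G ((fun x : ℝ => (w (P x)).re) '' Icc α β) := by
    refine kwl_continuousOn_omega ?_
    rintro _ ⟨x, hx, rfl⟩
    obtain ⟨u, hu, -, -, hwu⟩ := hPg x hx
    simp only
    rw [hwu, Complex.ofReal_re]
    have huS := hwinI u (huI u hu)
    exact ⟨fun heq => by have := hginj huS (hmkI 0) heq; linarith [hu.1],
      fun heq => by have := hginj huS (hmkI 1) heq; linarith [hu.1],
      fun heq => by have := hginj huS (hmkI 3) heq; linarith [hu.2]⟩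
  -- on the chord, `Φ ∘ P = |w′ ∘ P| · G(Re w ∘ P)`
  have hΦP : ∀ x ∈ Icc α β, Φ (P x) = ‖deriv w (P x)‖ * G ((w (P x)).re) := by
    intro x hx
    obtain ⟨u, -, -, -, hwu⟩ := hPg x hx
    simp only [hΦ, hG]
    rw [hwu, hwpt 0, hwpt 1, hwpt 3, Complex.ofReal_re, kwl_kernel_real]
  -- `Φ ∘ P` is continuous on the chord
  have hPc : Continuous P := by rw [hP]; fun_prop
  have hΦc : ContinuousOn (fun x : ℝ => Φ (P x)) (Icc α β) := by
    intro x hx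
    obtain ⟨u, hu, -, hbu, -⟩ := hPg x hx
    have hxU : P x ∈ U := hPU x hx
    have hwc : ContinuousAt (fun y : ℝ => w (P y)) x :=
      (hwd.differentiableAt (hUo.mem_nhds hxU)).continuousAt.comp hPc.continuousAt
    have hdc : ContinuousAt (fun y : ℝ => deriv w (P y)) x :=
      ((hwd.analyticOnNhd hUo).deriv.continuousOn.continuousAt (hUo.mem_nhds hxU)).comp
        hPc.continuousAt
    obtain ⟨hn0, hn1, hn3⟩ := hsep u (huI u hu)
    rw [hbu] at hn0 hn1 hn3
    have hp0 := norm_pos_iff.2 (sub_ne_zero.2 hn0)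
    have hp1 := norm_pos_iff.2 (sub_ne_zero.2 hn1)
    have hp3 := norm_pos_iff.2 (sub_ne_zero.2 hn3)
    have hbase : 0 < ‖w (P x) - w (R.pt 0)‖ ^ 2 * ‖w (P x) - w (R.pt 1)‖ ^ 2 *
        ‖w (P x) - w (R.pt 3)‖ ^ 2 := by positivity
    exact (hdc.norm.mul (((((hwc.sub continuousAt_const).norm.pow 2).mul
      ((hwc.sub continuousAt_const).norm.pow 2)).mul
      ((hwc.sub continuousAt_const).norm.pow 2)).rpow_const (Or.inl hbase.ne'))).continuousWithinAt
  -- part 5: the renormalised window mass converges to the side integral of `Φ`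
  have hlim := kwl_window_sum_tendsto R h1 hσ₁s hlt hs'σ₁' h3 hr hh hcl hop (N := N) (Φ := Φ) hNΦ hΦc
  -- part 4: the side integral is the beta integral between `g s` and `g s'`
  have hPs : ∀ t ∈ Icc s s', w (P (T t)) = g t := fun t ht => by
    rw [show P (T t) = R.boundary t from (kwl_eq_combo_of_nrmC (hh t (huI t ht))).symm]
    exact (hwin t (huI t ht)).2
  have hint : ∫ x in α..β, Φ (P x) = |∫ y in g s..g s', G y| := by
    rw [intervalIntegral.integral_congr fun x hx => hΦP x (by rwa [uIcc_of_le hαβ.le] at hx),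
      kwl_side_integral hUo hwd (Orient.norm_e o) hαβ hPU hreal hinj hGc hG0]
    rcases le_total (T s) (T s') with hle | hle
    · rw [show α = T s from inf_eq_left.2 hle, show β = T s' from sup_eq_right.2 hle,
        hPs s ⟨le_rfl, hlt.le⟩, hPs s' ⟨hlt.le, le_rfl⟩, Complex.ofReal_re, Complex.ofReal_re]
    · rw [show α = T s' from inf_eq_right.2 hle, show β = T s from sup_eq_left.2 hle,
        hPs s ⟨le_rfl, hlt.le⟩, hPs s' ⟨hlt.le, le_rfl⟩, Complex.ofReal_re, Complex.ofReal_re,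
        intervalIntegral.integral_symm, abs_neg]
  -- part 4: the increment of the continuum tail is `κ` times the same integral
  have hC : cardyFunction (crossRatio ![g (R.mark 0), g (R.mark 1), g s, g (R.mark 3)]) -
      cardyFunction (crossRatio ![g (R.mark 0), g (R.mark 1), g s', g (R.mark 3)]) =
      κ * |∫ y in g s..g s', G y| := by
    rw [hκ, hG]
    exact kwl_cardy_window_increment hgm (hmkI 0) (hmkI 1) (hmkI 3) (hwinI s hsI) (hwinI s' hs'I)
      h01 (h1.trans hσ₁s) hlt.le (hs'σ₁'.trans h3)
  -- conclusion
  have hmass : ∀ δ : ℝ, κ / N δ * (rowMass R δ s - rowMass R δ s') =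
      κ * ((∑ v ∈ rowTail R δ s \ rowTail R δ s', rowWeight R δ v) / N δ) := by
    intro δ
    rw [rowMass_sub_eq_sum_sdiff R δ (h1.le.trans hσ₁s.le) hlt.le (hs'σ₁'.le.trans h3.le)]
    ring
  simp_rw [hmass]
  rw [hC, ← hint]
  exact hlim.const_mul κ

end Summit.CriticalPhenomena.CardyFormulaZ2.Cruxes.RectilinearCardy.ExcursionKernelCovariance

end
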